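import Summits.BirchSwinnertonDyer.Rank1Residual.GaloisImage.KuriharaRecordCorollaryThree
import Summits.BirchSwinnertonDyer.Rank1Residual.Additive.X4RankZeroKuriharaWitnessNoLemma20
import Summits.BirchSwinnertonDyer.Rank1Residual.Additive.X4ThreeResCertKernel
import Summits.BirchSwinnertonDyer.Rank1Residual.X4.KimDefectParity
import Summits.BirchSwinnertonDyer.Rank1Residual.GaloisImage.KuriharaSelmerShaBookkeeping
import Summits.BirchSwinnertonDyer.Rank1Residual.GaloisImage.KolyvaginLevelOneUnitCaseOfFacts
import HarnessLib

/-!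
# R1-57-B (END-m1, record side), part 1: `BSD(E,3)` from `9 ∣ #Ш(E)[3^∞]` and ONE level-zero
# field `δ̃_1 ≢ 0 (mod 27)` — the sockets the level-one END (R1-57-A) plugs into
# (cell `b2b-bsdres`, team n1011, ROUTE-1 §33.3 sub-target R1-57; row T-R1-57-B; seat p18)

HONEST FRAMING (cell `b2b-bsdres`, run/shared/lean/b2b/bsd-rank1-residual/, verbatim in every
file): the goal of the cell is to DELETE the COMBINATION-SHAPED residual classes of the
Birch–Swinnerton-Dyer formula for ALL analytic-rank `≤ 1` elliptic curves over `ℚ` — "full BSD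
formula for every rank `≤ 1` curve in class `C`" assembled STRICTLY from published theorems — so
that the rank-`≤ 1` remainder becomes exactly the CONSTRUCTION-SHAPED classes, which are TYPED
(missing-input `Prop`s), NOT attempted. This is not "finishing BSD". Team n1011 (N10/N11, the
additive block `X4 ∧ p = 3`): research route; PER-PAIR record shape, NOT a class theorem; TOOL
theorems only (no definition, no named fact); nothing booked; no mark / label moved.  END-m1 is
WEAKER than the S24-DEEP pair END `Assembly.bsdp_three_of_towerSurj_of_pairCertificate` (it
closes `BSD(E,3)` only where `ord₃(L(E,1)/Ω_E) ≤ 2`); its value is DEBT REDUCTION (no [S24] Thm.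
4.4 (1)(2) at any level once R1-56 (G) lands), not coverage.  CONDITIONAL on the UPPER-half facts
of the X4 chain of record exactly as `KuriharaRecordBSDpThree` (`hKatoS hDel hmodD hKatoχ`, with
`hGZK`, `hmod`, `h26`; Wuthrich's Lemma 20 is the tree theorem `…_holds`, so NO `hL20`).

## What and why (r1 ROUTE-1 §33.3, lead R5-67 ADDENDUM 1 (θ))

END-m1 (sub-target R1-57): on a class-A1 row (additive at `3`, `3 ∤ c₃`, `#E(ℚ₃)[3] = 1`,
surj(3), `r_an = 0`) ONE level-one Kurihara unit `δ̃_n ≢ 0 (mod 3)` together with `3 ∣ [0]⁺`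
gives `Ш(E)[3] ≠ 0`, hence (Cassels–Tate) `9 ∣ #Ш(E)[3^∞]` — FILE R1-57-A (owner p09, the
datum-currency END over p11's injectivity theorem G5 / interim the slice `hS24₁`).  THIS file is
the record side, part 1 = everything that does NOT depend on A's statement:

* `Assembly.exists_LOmega_padicValRat_le_of_sq_dvd_card_sha` — the LEVEL-ZERO WITNESS: from
  `3² ∣ #Ш(E)[3^∞]` and the level-zero field `δ̃_1 ≢ 0 (mod 3³)` (i.e. `ord₃(L(E,1)/Ω_E) ≤ 2`;
  `δ̃_1 = [0]⁺ = L(E,1)/Ω⁺_f`, `kuriharaNumber_one`), the LOWER-half output shape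
  `∃ q, L(E,1)/Ω(W) = q ∧ ord₃ q ≤ ord₃ #Ш(E)[3^∞]` — by this seat's `LValue.exists_lValue_witness`
  (`δ̃_1 ≡ 3^v · unit (mod 3^K)` at every `K`, `v = ord₃ q`, period transfer from the optimal
  datum): `v ≤ 2 ≤ ord₃ #Ш`;
* `Assembly.sq_dvd_card_sha_three_of_dvd_of_casselsTate` — `3 ∣ #Ш(E)[3^∞]` + Cassels–Tate
  (`hCT`, `Ш` finite) ⟹ `9 ∣ #Ш(E)[3^∞]` (r1 §33.3 step (5); bridge for whichever shape A exports);
* `Assembly.sq_dvd_card_sha_three_of_exists_selmer_ne_zero` — `Sel₃(E) ≠ 0` (the currency of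
  FILE R1-57-A's END, p09 HOME/INBOX 16:13Z/16:16Z) + rank `0` + `E[3]` irreducible + `hCT` ⟹
  `9 ∣ #Ш(E)[3^∞]` (`3 • Sel₃ = 0`, `#Sel₃ ∣ #Ш(E)[3^∞]` by `SelmerSha.card_dvd_and_nsmul_eq_zero`);
* `Assembly.bsdp_three_of_towerSurj_of_sq_dvd_card_sha` (potentially good, `3 ∤ ∏ c_ℓ`) and
  `Assembly.bsdp_three_potMult_of_sq_dvd_card_sha` (`ord₃ j < 0`) — `BSD(E,3)` from the UPPER
  facts, the row, the optimal datum, `3² ∣ #Ш(E)[3^∞]` and `δ̃_1 ≢ 0 (mod 27)`, through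
  additive-p4's sockets `X4RankZero.bsdp_three_of_towerSurj_of_optimal_of_LOmegaWitness_noL20` /
  `X4RankZero.bsdp_three_potMult_of_LOmegaWitness_noL20`.

* `Assembly.dictionaryThreeOneAt_of_port` — the cell's ONE port binder `KatoKuriharaPortThreeAt W 0 v₃`
  (the pair END's) yields the LEVEL-ONE dictionary `KatoKuriharaDictionaryThreeOneAt W 0 D v₃`
  (the `hDict` of FILE R1-57-A and of the EXOTIC ENDs) for the pinned canonical `τ`-datum — by
  `k = k′ = 0` in the port, `katoKuriharaDictionaryThreeAt_of_two`, and p13's `Iff.rfl` respelling.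

Part 2 (after FILE R1-57-A's END is in the tree, name and binders fixed by its owner) adds the
END corollary of record `Assembly.bsdp_three_of_towerSurj_of_levelOneCertificates` = these sockets
with `3² ∣ #Ш(E)[3^∞]` DISCHARGED by A from {PORT@1, the Poitou–Tate family at `3`, `hEP`, the
level-one certificate `δ̃_n ≢ 0 (mod 3)` with B1's cyclicity flag, `δ̃_1 ≡ 0 (mod 3)`, `hCT`,
p11's G5 (interim `hS24₁`)} — binder list = r1 §33.3's, nothing else (S-B1 discipline).

The level-zero fields are per-record EVIDENCE (the value `[0]⁺ = L(E,1)/Ω⁺_f` of the optimal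
newform, two engines), like every `δ̃` value of the cell's records; `δ̃_1` does not depend on the
discrete logarithms `ψ` (`kuriharaNumber_one`), so the modulus-`27` field carries its own `ψ₂₇`.

References: C.-H. Kim, AJM 148 (2026) Thm. 1.9 (6), §1.4.3 [Kim2022StructureSelmer]; M. Kurihara,
Münster J. Math. 7 (2014) §1.1 [Kurihara2014]; K. Kato, Astérisque 295 (2004) Thm. 14.5 (3)
[Kato2004Asterisque]; A. Agashe, K. Ribet, W. Stein (2006) Thm. 2.6 [AgasheRibetStein2006];
R. L. Miller, LMS JCM 14 (2011) Def. 1.1 [Miller2011LMS].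
-/

noncomputable section

open scoped Classical NumberField ContRepresentation
open Function Field NumberField IsDedekindDomain IsDedekindDomain.HeightOneSpectrum WeierstrassCurve
  CongruenceSubgroup
  Literature.NumberTheory.EllipticCurves Literature.NumberTheory.EllipticCurves.ModularForms
  Literature.NumberTheory.EllipticCurves.Rank1Residual
  Literature.NumberTheory.EllipticCurves.AgasheRibetStein2006
  Literature.NumberTheory.GaloisRepresentations
  Literature.NumberTheory.GaloisRepresentations.DiscreteGaloisModule Literature.NumberTheory.GaloisCohomology
  Rat.HeightOneSpectrum
  Summit.BirchSwinnertonDyer.Rank1Residual.Additive Summit.BirchSwinnertonDyer.Rank1Residual.X4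

namespace Summit.BirchSwinnertonDyer.Rank1Residual.GaloisImage.Assembly

/-! ### The level-zero witness -/

/-- **The LEVEL-ZERO WITNESS of END-m1.**  `W/ℚ` globally minimal with `ρ̄_{E,3}` onto and analytic
rank `0`, an OPTIMAL parametrisation datum `D` at a level `N ≤ 130000` (so `3 ∤ c_D` and
`Ω(W) = u · Ω⁺_f`, `|u|₃ = 1`); IF `3² ∣ #Ш(E)[3^∞]` (the conclusion of the level-one END R1-57-A)
and the level-zero Kurihara number does not vanish mod `27` — `δ̃_1 = [0]⁺ ≢ 0 (mod 3³)`, i.e.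
`ord₃(L(E,1)/Ω_E) ≤ 2` — THEN `∃ q, L(E,1)/Ω(W) = q ∧ ord₃ q ≤ ord₃ #Ш(E)[3^∞]`, the LOWER-half
output shape of the cell's `BSD(E,3)` sockets.  (`δ̃_1 ≡ 3^v·unit (mod 3^K)` for every `K` with
`v = ord₃ q`, `LValue.exists_lValue_witness`; at `K = 3` non-vanishing forces `v ≤ 2`.)
[cite: Kim2022StructureSelmer, §1.4.3 (PDF p. 7)] [cite: Kurihara2014, §1.1 (PDF p. 2)]
[cite: AgasheRibetStein2006, Thm. 2.6 (p. 619)] -/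
theorem exists_LOmega_padicValRat_le_of_sq_dvd_card_sha
    (hGZK : rank_eq_analyticRank_of_analyticRank_le_one) (hmod : hasEntireLFunction_rat)
    (h26 : cremona_abs_maninConstant_eq_one_of_level_le)
    (W : WeierstrassCurve ℚ) [W.IsElliptic] [W.IsGloballyMinimal]
    (hsurj : W.HasSurjectiveModNGaloisRep 3) (hr : W.analyticRank = 0)
    {N : ℕ} [NeZero N] (hN : N ≤ 130000) (D : ModularParametrizationData W N)
    (hopt : ∀ z ∈ D.L.lattice, ∃ w ∈ periodLattice D.f, z = D.c * w)
    (h9 : 3 ^ 2 ∣ Nat.card (AddCommGroup.primaryComponent W.sha 3))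
    (ψ₂₇ : (ℓ : ℕ) → (ZMod ℓ)ˣ →* Multiplicative (ZMod (3 ^ 3)))
    (hunit₁ : kuriharaNumber D.f (3 ^ 3) 1 ψ₂₇ ≠ 0) :
    ∃ q : ℚ, W.entireLFunction 1 / (W.realPeriodRat : ℂ) = (q : ℂ) ∧
      padicValRat 3 q ≤ (padicValNat 3 (Nat.card (AddCommGroup.primaryComponent W.sha 3)) : ℤ) := by
  haveI : Fact (Nat.Prime 3) := ⟨Nat.prime_three⟩
  -- `L(E,1) ≠ 0`, `Ш` finite (GZK at rank `0`)
  have hL : W.entireLFunction 1 ≠ 0 := by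
    rw [← W.leadingLCoeff_eq_of_analyticRank_eq_zero hr]
    exact W.leadingLCoeff_ne_zero_holds (hmod W)
  have hGZ := hGZK W (by rw [hr]; exact zero_le_one)
  haveI : Finite W.sha := hGZ.2
  -- the optimal datum: `3 ∤ c_D`, the period transfer
  have hcD : ¬ (3 : ℤ) ∣ D.maninConstant :=
    not_dvd_maninConstant_of_level_le h26 W D hopt hN Nat.prime_three
  have hper : ∃ u : ℚ, ‖(u : ℚ_[3])‖ = 1 ∧ W.realPeriodRat = u * plusPeriod D.f :=
    periodTransfer_of_optimal 3 D hopt hcD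
  have hirr : W.HasIrreducibleModPGaloisRep 3 :=
    hasIrreducibleModPGaloisRep_of_hasSurjectiveModNGaloisRep W 3 hsurj
  -- the `L`-value witness: `L/Ω = q`, `ord₃ q = v`, `δ̃_1 ≡ 3^v · unit (mod 3^K)` for all `K`
  obtain ⟨q, v, hq, hv, hshape⟩ := LValue.exists_lValue_witness W 3 (by norm_num) hirr hL D hper
  refine ⟨q, hq, ?_⟩
  -- `v ≤ 2` from the modulus-`27` field
  have hv2 : v ≤ 2 := by
    by_contra hlt
    have h3v : 3 ≤ v := by omega
    obtain ⟨w₀, hw₀⟩ := hshape 3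
    apply hunit₁
    rw [hw₀ ψ₂₇]
    have h27 : ((3 ^ v : ℕ) : ZMod (3 ^ 3)) = 0 := by
      rw [ZMod.natCast_eq_zero_iff]
      exact pow_dvd_pow 3 h3v
    rw [h27, zero_mul]
  -- `2 ≤ ord₃ #Ш(E)[3^∞]` from `9 ∣ #Ш(E)[3^∞]` (a finite non-trivial cardinal)
  have hcard : Nat.card (AddCommGroup.primaryComponent W.sha 3) ≠ 0 := by
    haveI : Finite (AddCommGroup.primaryComponent W.sha 3) := inferInstance
    exact Nat.card_pos.ne'
  have h2 : 2 ≤ padicValNat 3 (Nat.card (AddCommGroup.primaryComponent W.sha 3)) :=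
    (padicValNat_dvd_iff_le hcard).mp h9
  rw [hv]
  exact_mod_cast hv2.trans h2

/-- **`3 ∣ #Ш(E)[3^∞]` and Cassels–Tate give `9 ∣ #Ш(E)[3^∞]`** (`Ш` finite): the order of the
`3`-primary part is a square (`X4.KimDefectParity.even_padicValNat_card_shaPrimary_of_casselsTate`),
so an exponent `≥ 1` is `≥ 2` — the bridge from the level-one END's `Ш(E)[3] ≠ 0` (r1 §33.3 step
(5)) to the hypothesis `h9` of the sockets below, whichever of the two shapes FILE R1-57-A exports.
[cite: SilvermanAEC2009, Thm. X.4.14] -/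
theorem sq_dvd_card_sha_three_of_dvd_of_casselsTate (hCT : exists_casselsTate_pairing (K := ℚ))
    (W : WeierstrassCurve ℚ) [W.IsElliptic] [Finite W.sha]
    (h3 : 3 ∣ Nat.card (AddCommGroup.primaryComponent W.sha 3)) :
    3 ^ 2 ∣ Nat.card (AddCommGroup.primaryComponent W.sha 3) := by
  haveI : Fact (Nat.Prime 3) := ⟨Nat.prime_three⟩
  have hcard : Nat.card (AddCommGroup.primaryComponent W.sha 3) ≠ 0 := Nat.card_pos.ne'
  have h1 : 1 ≤ padicValNat 3 (Nat.card (AddCommGroup.primaryComponent W.sha 3)) :=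
    (padicValNat_dvd_iff_le hcard).mp (by simpa using h3)
  obtain ⟨k, hk⟩ := X4.even_padicValNat_card_shaPrimary_of_casselsTate W 3 hCT ‹_›
  exact (padicValNat_dvd_iff_le hcard).mpr (by omega)

/-- **`Sel₃(E) ≠ 0` (the conclusion of the level-one END R1-57-A, p09's currency) gives
`9 ∣ #Ш(E)[3^∞]`** in rank `0` with `E[3]` irreducible, `E(ℚ)` and `Ш` finite, and Cassels–Tate:
`Sel^(3)(E/ℚ) = H¹_𝒦(ℚ, E[3])` is killed by `3` (`galoisCohomology.nsmul_eq_zero_of_forall`), so a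
non-zero Selmer class has order `3` and `3 ∣ #Sel₃`; `#Sel₃ ∣ #Ш(E)[3^∞]` (this seat's
`SelmerSha.card_dvd_and_nsmul_eq_zero`, Silverman X.4.2 (a) with `E(ℚ)[3] = 0`); then the square
(`sq_dvd_card_sha_three_of_dvd_of_casselsTate`). [cite: SilvermanAEC2009, Thm. X.4.2 (a) and X.4.14] -/
theorem sq_dvd_card_sha_three_of_exists_selmer_ne_zero (hCT : exists_casselsTate_pairing (K := ℚ))
    (W : WeierstrassCurve ℚ) [W.IsElliptic] [Finite W.toAffine.Point] [Finite W.sha]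
    (hirr : W.HasIrreducibleModPGaloisRep 3)
    (hSel : ∃ x ∈ (W.kummerSelmerStructure ((3 : ℕ) : ℤ)).selmerGroup, x ≠ 0) :
    3 ^ 2 ∣ Nat.card (AddCommGroup.primaryComponent W.sha 3) := by
  haveI : Fact (Nat.Prime 3) := ⟨Nat.prime_three⟩
  obtain ⟨x, hx, hx0⟩ := hSel
  -- `#Sel₃ ∣ #Ш(E)[3^∞]`
  have key := (SelmerSha.card_dvd_and_nsmul_eq_zero W 3 hirr 0).1
  rw [show ((3 : ℕ) : ℤ) ^ 0 * ((3 : ℕ) : ℤ) = ((3 : ℕ) : ℤ) by norm_num] at key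
  set Sel := (W.kummerSelmerStructure ((3 : ℕ) : ℤ)).selmerGroup with hSeldef
  have hcard : Nat.card (AddCommGroup.primaryComponent W.sha 3) ≠ 0 := Nat.card_pos.ne'
  haveI : Finite Sel := Nat.finite_of_card_ne_zero fun h => hcard (Nat.eq_zero_of_zero_dvd (h ▸ key))
  -- a non-zero `3`-Selmer class has order `3`
  have h3x : addOrderOf (⟨x, hx⟩ : Sel) = 3 := by
    have hkill : 3 • (⟨x, hx⟩ : Sel) = 0 := by
      refine Subtype.ext ?_
      simpa using galoisCohomology.nsmul_eq_zero_of_forall (W.torsionGaloisModule ((3 : ℕ) : ℤ))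
        (n := 3) (fun T => by simpa using W.natAbs_nsmul_geomTorsion T) x
    rcases (Nat.dvd_prime Nat.prime_three).mp (addOrderOf_dvd_of_nsmul_eq_zero hkill) with h1 | h3
    · exact absurd (AddMonoid.addOrderOf_eq_one_iff.mp h1) (fun h => hx0 (congrArg Subtype.val h))
    · exact h3
  have h3 : 3 ∣ Nat.card Sel := by
    have h := addOrderOf_dvd_natCard (⟨x, hx⟩ : Sel)
    rwa [h3x] at h
  exact sq_dvd_card_sha_three_of_dvd_of_casselsTate hCT W (h3.trans key)

/-! ### `BSD(E,3)` sockets from `9 ∣ #Ш(E)[3^∞]` -/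

/-- **`BSD(E,3)` from `3² ∣ #Ш(E)[3^∞]` and `δ̃_1 ≢ 0 (mod 27)` — potentially good, unit Tamagawa
(class A1-UNIT rows).**  Record shape of `KuriharaRecordBSDpThree`: the UPPER-half facts of the X4
chain of record (`hKatoS hDel hmodD hKatoχ`; `hGZK hmod h26`; NO `hL20` — Wuthrich's Lemma 20 is
the tree's theorem), the row by its integral model (`3 ∣ Δ`, `3 ∣ c₄` ⟹ `Addv`), the `3`-adic
tower (UPPER side), `r_an = 0`, `3 ∤ ∏ c_ℓ`, an optimal datum at `N ≤ 130000`; LOWER side: the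
hypothesis `3² ∣ #Ш(E)[3^∞]` (discharged by the level-one END R1-57-A in part 2) and the
level-zero field.  Socket: additive-p4's
`X4RankZero.bsdp_three_of_towerSurj_of_optimal_of_LOmegaWitness_noL20`.
[cite: Kato2004Asterisque, Thm. 14.5 (3) (p. 236)] [cite: AgasheRibetStein2006, Thm. 2.6 (p. 619)]
[cite: Miller2011LMS, §1 and Def. 1.1] -/
theorem bsdp_three_of_towerSurj_of_sq_dvd_card_sha
    (hKatoS : Kato2004.rankZero_padicValNat_sha_le_sub_localTamagawa_of_additive_potGood_of_imageContainsSL2)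
    (hDel : Delbourgo1998.prop4_rankZero_pow_dvd_constantCoeff)
    (hGZK : rank_eq_analyticRank_of_analyticRank_le_one) (hmod : hasEntireLFunction_rat)
    (hmodD : nonempty_modularParametrizationData)
    (hKatoχ : Wuthrich2014.kato_halfEigenCharIdeal_dvd_cyclotomicPrime_of_surjective)
    (h26 : cremona_abs_maninConstant_eq_one_of_level_le)
    (W : WeierstrassCurve ℚ) [W.IsElliptic] [W.IsGloballyMinimal]
    {E₀ : WeierstrassCurve ℤ} (hI : integralModelInt W = E₀)
    (hΔ : (3 : ℤ) ∣ E₀.Δ) (hc₄ : (3 : ℤ) ∣ E₀.c₄)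
    (htower : ∀ m : ℕ, W.HasSurjectiveModNGaloisRep (3 ^ m : ℕ))
    (hr : W.analyticRank = 0) (htam : ¬ 3 ∣ W.tamagawaProduct)
    {N : ℕ} [NeZero N] (hN : N ≤ 130000) (D : ModularParametrizationData W N)
    (hopt : ∀ z ∈ D.L.lattice, ∃ w ∈ periodLattice D.f, z = D.c * w)
    (h9 : 3 ^ 2 ∣ Nat.card (AddCommGroup.primaryComponent W.sha 3))
    (ψ₂₇ : (ℓ : ℕ) → (ZMod ℓ)ˣ →* Multiplicative (ZMod (3 ^ 3)))
    (hunit₁ : kuriharaNumber D.f (3 ^ 3) 1 ψ₂₇ ≠ 0) :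
    BSDp W 3 := by
  haveI : Fact (Nat.Prime 3) := ⟨Nat.prime_three⟩
  have hadd : Addv W 3 := addv_of_intModel hI 3 (by exact_mod_cast hΔ) (by exact_mod_cast hc₄)
  have hsurj : W.HasSurjectiveModNGaloisRep 3 := by simpa using htower 1
  obtain ⟨q₀, hq₀, hw⟩ := exists_LOmega_padicValRat_le_of_sq_dvd_card_sha hGZK hmod h26 W hsurj hr
    hN D hopt h9 ψ₂₇ hunit₁
  exact X4RankZero.bsdp_three_of_towerSurj_of_optimal_of_LOmegaWitness_noL20 W hKatoS hDel hGZK hmod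
    hmodD hKatoχ h26 hadd hsurj htower hr htam hN ⟨D, hopt⟩ hq₀ hw

/-- **`BSD(E,3)` from `3² ∣ #Ш(E)[3^∞]` and `δ̃_1 ≢ 0 (mod 27)` — potentially MULTIPLICATIVE rows
(`ord₃ j < 0`, class A1-(M)).**  As `bsdp_three_of_towerSurj_of_sq_dvd_card_sha` through
additive-p1's `ω`-branch socket `X4RankZero.bsdp_three_potMult_of_LOmegaWitness_noL20` (no tower,
Tamagawa or Manin binder on the UPPER half; the tower is not needed at all here, surj(3) is).
[cite: Delbourgo1998, Prop. 4 (p. 144)] [cite: AgasheRibetStein2006, Thm. 2.6 (p. 619)]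
[cite: Miller2011LMS, §1 and Def. 1.1] -/
theorem bsdp_three_potMult_of_sq_dvd_card_sha
    (hKatoS : Kato2004.rankZero_padicValNat_sha_le_sub_localTamagawa_of_additive_potGood_of_imageContainsSL2)
    (hDel : Delbourgo1998.prop4_rankZero_pow_dvd_constantCoeff)
    (hGZK : rank_eq_analyticRank_of_analyticRank_le_one) (hmod : hasEntireLFunction_rat)
    (hmodD : nonempty_modularParametrizationData)
    (hKatoχ : Wuthrich2014.kato_halfEigenCharIdeal_dvd_cyclotomicPrime_of_surjective)
    (h26 : cremona_abs_maninConstant_eq_one_of_level_le)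
    (W : WeierstrassCurve ℚ) [W.IsElliptic] [W.IsGloballyMinimal]
    {E₀ : WeierstrassCurve ℤ} (hI : integralModelInt W = E₀)
    (hΔ : (3 : ℤ) ∣ E₀.Δ) (hc₄ : (3 : ℤ) ∣ E₀.c₄)
    (hsurj : W.HasSurjectiveModNGaloisRep 3) (hjneg : padicValRat 3 W.j < 0)
    (hr : W.analyticRank = 0)
    {N : ℕ} [NeZero N] (hN : N ≤ 130000) (D : ModularParametrizationData W N)
    (hopt : ∀ z ∈ D.L.lattice, ∃ w ∈ periodLattice D.f, z = D.c * w)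
    (h9 : 3 ^ 2 ∣ Nat.card (AddCommGroup.primaryComponent W.sha 3))
    (ψ₂₇ : (ℓ : ℕ) → (ZMod ℓ)ˣ →* Multiplicative (ZMod (3 ^ 3)))
    (hunit₁ : kuriharaNumber D.f (3 ^ 3) 1 ψ₂₇ ≠ 0) :
    BSDp W 3 := by
  haveI : Fact (Nat.Prime 3) := ⟨Nat.prime_three⟩
  have hadd : Addv W 3 := addv_of_intModel hI 3 (by exact_mod_cast hΔ) (by exact_mod_cast hc₄)
  have hX : ClassX4 W 3 :=
    ⟨by norm_num, hadd, hasIrreducibleModPGaloisRep_of_hasSurjectiveModNGaloisRep W 3 hsurj⟩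
  obtain ⟨q₀, hq₀, hw⟩ := exists_LOmega_padicValRat_le_of_sq_dvd_card_sha hGZK hmod h26 W hsurj hr
    hN D hopt h9 ψ₂₇ hunit₁
  exact X4RankZero.bsdp_three_potMult_of_LOmegaWitness_noL20 W hKatoS hDel hGZK hmod hmodD hKatoχ hr
    hX hsurj hjneg hq₀ (j := 0) (Nat.zero_le _) (by simpa using hw)

/-! ### The level-one dictionary from the universal-closure PORT -/

/-- **PORT@1 ⟹ DICT3₁ for the pinned canonical `τ`-datum, in the `E[3]` spelling.**  The cell's ONE
port hypothesis `KatoKuriharaPortThreeAt W 0 v₃` (FILE C of T-R1-45, p279915: the two-level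
dictionary for ALL guarded canonical `τ`-data at all depths) specialised to `k = k′ = 0`, the datum
`D` on `E[3]` read as a datum on `E[3^0·3]` (the same type by evaluation), a reduction map
`E[3^0·3] → E[3^0·3]` pinned to `x ↦ 3^0·x` (n1011-p11 `exists_torsionReduction_three W 0 0`), the
refinement `katoKuriharaDictionaryThreeAt_of_two` (two-level ⟹ one-level at the lower depth) and
n1011-p13's `katoKuriharaDictionaryThreeAt_zero_iff_threeOneAt` (ONE PORT, TWO SPELLINGS, `Iff.rfl`)
give `KatoKuriharaDictionaryThreeOneAt W 0 D v₃` — the hypothesis `hDict` of the level-one END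
R1-57-A (p09) and of the EXOTIC ENDs (p13 / p09 K6).  So an END-m1 record carries the SAME `hPort`
binder as the pair END `bsdp_three_of_towerSurj_of_pairCertificate` (r1 §33.3: "PORT@1").
[cite: Kim2022StructureSelmer, Thm. 3.13 and §3.3–§3.4.1 (arXiv pp. 17–18)] -/
theorem dictionaryThreeOneAt_of_port (W : WeierstrassCurve ℚ) [W.IsElliptic] [W.IsGloballyMinimal]
    [Finite (geomTorsion W ((3 : ℕ) : ℤ))]
    {v₃ : HeightOneSpectrum (𝓞 ℚ)} (hPort : KatoKuriharaPortThreeAt W 0 v₃)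
    {S : Set (HeightOneSpectrum (𝓞 ℚ))}
    (hS : ∀ v ∉ S, W.HasGoodReductionAt v ∧ ((3 : ℕ) : 𝓞 ℚ) ∉ v.asIdeal)
    {τ : absoluteGaloisGroup ℚ} (hτμ : τ ∈ rootsOfUnityFixer ℚ 3)
    (hτq : Nonempty (cokerSubOne (W.torsionGaloisModule ((3 : ℕ) : ℤ)) τ ≃+ ZMod 3))
    {D : KolyvaginDatum (W.torsionGaloisModule ((3 : ℕ) : ℤ))}
    (hP : D.primes = frobeniusClassPrimes (W.torsionGaloisModule ((3 : ℕ) : ℤ)) S τ 3)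
    (hT : D.transverse = cyclotomicTransverse (W.torsionGaloisModule ((3 : ℕ) : ℤ)))
    {η : (q : HeightOneSpectrum (𝓞 ℚ)) → (ZMod (Ideal.absNorm q.asIdeal))ˣ}
    (hD : D.HasCanonicalComparison 3 η) :
    KatoKuriharaDictionaryThreeOneAt W 0 D v₃ := by
  -- read `D` as a datum for `E[3^0·3]` (the same type by evaluation) and pass the guard at depth `0`
  have hguard : KolyvaginDatum.IsCanonicalTauDatumThreeAt W (0 + 0) 0
      (D : KolyvaginDatum (W.torsionGaloisModule (((3 : ℕ) : ℤ) ^ 0 * ((3 : ℕ) : ℤ)))) :=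
    isCanonicalTauDatumThreeAt_of_primes_eq (W := W) (k := 0)
      (D := (D : KolyvaginDatum (W.torsionGaloisModule (((3 : ℕ) : ℤ) ^ 0 * ((3 : ℕ) : ℤ)))))
      hS (τ := τ) hτμ hτq hP hT (η := η) hD
  -- the port at `k = k′ = 0` with the pinned reduction map, refined to one level, then respelled
  obtain ⟨red, hred⟩ := exists_torsionReduction_three W 0 0
  have h₁ : KatoKuriharaDictionaryThreeAt W 0 0
      (D : KolyvaginDatum (W.torsionGaloisModule (((3 : ℕ) : ℤ) ^ 0 * ((3 : ℕ) : ℤ)))) v₃ :=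
    katoKuriharaDictionaryThreeAt_of_two (hPort 0 0 _ _ red hguard hguard) le_rfl hred
  exact (katoKuriharaDictionaryThreeAt_zero_iff_threeOneAt W 0 D v₃).mp h₁

/-- **The PORT at ANY depth pins the one-level dictionary for a guarded datum** (GEN 6 append, the
generic form of `dictionaryThreeOneAt_of_port`; r1 ROUTE-1 §35.2: "pin only on the record side by the
`t = 1` twin of `dictionaryThreeOneAt_of_port`"): `KatoKuriharaPortThreeAt W t v₃` (FILE C of T-R1-45)
at `k = k′` with the reduction map `E[3^{k+1}] → E[3^{k+1}]` pinned to `x ↦ 3^0·x`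
(`exists_torsionReduction_three W k k`) and the refinement `katoKuriharaDictionaryThreeAt_of_two` give
`KatoKuriharaDictionaryThreeAt W k t D v₃` for every datum `D` on `E[3^{k+1}]` passing the guard
`IsCanonicalTauDatumThreeAt W (k + t) k` (primes in the class of depth `k + t` — (B6)).  At
`(k, t) = (1, 1)` this is the pin END-m2 records need (T-INJ-DEV's datum-generic END takes
`hDict : KatoKuriharaDictionaryThreeAt W 1 1 D v₃`; the guard is met by
`isCanonicalTauDatumThreeAt_of_primes_eq_deep` with `τ ∈ μ₂₇-fixer`, (H.2) on `E[27]`, primes in the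
`27`-class, canonical comparison at `9`).
[cite: Kim2022StructureSelmer, Thm. 3.13 and §3.3–§3.4.1 (arXiv pp. 17–18)] -/
theorem dictionaryThreeAt_of_port (W : WeierstrassCurve ℚ) [W.IsElliptic] [W.IsGloballyMinimal]
    {t : ℕ} {v₃ : HeightOneSpectrum (𝓞 ℚ)} (hPort : KatoKuriharaPortThreeAt W t v₃) {k : ℕ}
    {D : KolyvaginDatum (W.torsionGaloisModule (((3 : ℕ) : ℤ) ^ k * ((3 : ℕ) : ℤ)))}
    (hD : D.IsCanonicalTauDatumThreeAt W (k + t) k) :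
    KatoKuriharaDictionaryThreeAt W k t D v₃ := by
  obtain ⟨red, hred⟩ := exists_torsionReduction_three W k k
  exact katoKuriharaDictionaryThreeAt_of_two (hPort k k D D red hD hD) le_rfl hred

/-- **The `(k, t) = (1, 1)` pin for END-m2 records** (class A2, `#E(ℚ₃)[3] = 3`): from the ONE port
`KatoKuriharaPortThreeAt W 1 v₃` and a canonical `τ`-datum on `E[9]` with primes in Sakamoto's
`27`-class (`τ ∈ μ₂₇`-fixer, `E[27]/(τ − 1) ≃ ℤ/27`, `𝒫(D) = frobeniusClassPrimes (E[27]) S τ 27`,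
cyclotomic transverse conditions, canonical comparison maps at `9`), the dictionary
`KatoKuriharaDictionaryThreeAt W 1 1 D v₃`.  (r1 ROUTE-1 §35.2 / §35.3: on a mod-`27`-surjective row the
`27`-class is `{ℓ ≡ 1 (27), 27 ∣ #Ẽ(𝔽_ℓ), Ẽ(𝔽_ℓ)[3] ≅ ℤ/3}`.)
[cite: Kim2022StructureSelmer, Thm. 3.13] [cite: Sakamoto2024, §2 and Def. 4.1] -/
theorem dictionaryThreeAt_one_one_of_port (W : WeierstrassCurve ℚ) [W.IsElliptic] [W.IsGloballyMinimal]
    {v₃ : HeightOneSpectrum (𝓞 ℚ)} (hPort : KatoKuriharaPortThreeAt W 1 v₃)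
    {S : Set (HeightOneSpectrum (𝓞 ℚ))}
    (hS : ∀ v ∉ S, W.HasGoodReductionAt v ∧ ((3 : ℕ) : 𝓞 ℚ) ∉ v.asIdeal)
    {τ : absoluteGaloisGroup ℚ} (hτμ : τ ∈ rootsOfUnityFixer ℚ (3 ^ (2 + 1)))
    (hτq : Nonempty (cokerSubOne (W.torsionGaloisModule (((3 : ℕ) : ℤ) ^ 2 * ((3 : ℕ) : ℤ))) τ ≃+
      ZMod (3 ^ (2 + 1))))
    {D : KolyvaginDatum (W.torsionGaloisModule (((3 : ℕ) : ℤ) ^ 1 * ((3 : ℕ) : ℤ)))}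
    (hP : D.primes = frobeniusClassPrimes (W.torsionGaloisModule (((3 : ℕ) : ℤ) ^ 2 * ((3 : ℕ) : ℤ)))
      S τ (3 ^ (2 + 1)))
    (hT : D.transverse = cyclotomicTransverse (W.torsionGaloisModule (((3 : ℕ) : ℤ) ^ 1 * ((3 : ℕ) : ℤ))))
    {η : (q : HeightOneSpectrum (𝓞 ℚ)) → (ZMod (Ideal.absNorm q.asIdeal))ˣ}
    (hD : D.HasCanonicalComparison (3 ^ (1 + 1)) η) :
    KatoKuriharaDictionaryThreeAt W 1 1 D v₃ :=
  dictionaryThreeAt_of_port W hPort (isCanonicalTauDatumThreeAt_of_primes_eq_deep hS hτμ hτq hP hT hD)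

end Summit.BirchSwinnertonDyer.Rank1Residual.GaloisImage.Assembly

end
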